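import Literature.NumberTheory.EllipticCurves.TateCurve.NumberFieldUniformizationTwisted
import Literature.NumberTheory.EllipticCurves.TateCurve.SplitOfOddTorsion
import Literature.NumberTheory.EllipticCurves.TateCurve.Twist
import Literature.NumberTheory.EllipticCurves.TateCurve.UniformizationProofs
import Literature.NumberTheory.EllipticCurves.TateParametrisationTorsion
import Mathlib.FieldTheory.Galois.Infinite
import HarnessLib

/-!
# Route `KolyvaginRoadThree`, deciding crux `ZhangSharpFrameAtThreeHL` (item stmt-BirchSwinnertonDyer-19574), first floor of stub S1
# on RATIONAL level-raised frames — hypothesis hygiene for the raising place: SPLIT multiplicative reduction from ONE rational point of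
# odd prime order `p` when `μ_p ⊂ K_v` (Silverman ATAEC V.5.3 ∕ Cor. V.5.4)
# (cell `bsd-stepL`, seat `bsd-stepL-koly3b` g7 (PART 1b ACCEL seat (10)); `--supports stmt-BirchSwinnertonDyer-19574`, helper)

WHAT. The GP2@3-RATIONAL theorems of this seat (`…RationalLiftGrossParsonAtThree`, `…RationalLiftSelmerIdentification`) carry the
hypothesis «the `3`-congruent curve `E′` has SPLIT multiplicative reduction at the place `v ∣ q` of `K`». At a unipotent-admissible `q`
this is automatic once `E′` is multiplicative at `v` and has a `K_v`-rational point of order `3` (which it has: `E′[3] ≅ E[3]` and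
`E[3]^{Γ_{K_v}}` is a line), because `μ₃ ⊂ K_v`. This file proves the two general local facts behind that remark:

* `hasSplitMultiplicativeReductionAt_of_isSquare_gamma` — (ii) ⇒ (iii) of Silverman ATAEC Thm. V.5.3 (b) at a finite place of a number
  field: multiplicative reduction at `v` and `γ(E/K) = −c₄/c₆` a square in `K_v` ⟹ SPLIT multiplicative reduction at `v` (tree: Tate
  parameter `existsUnique…`∕`isomorphic_tateCurve_of_one_lt_norm_j_holds`, `iso_tateCurve_of_isSquare_gamma`,
  `hasSplitMultiplicativeReductionAt_of_iso_tateCurve`).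
* `hasSplitMultiplicativeReductionAt_of_fixed_torsion_point` — multiplicative reduction at `v`, an odd prime `p` with `μ_p ⊂ K_v`
  (every `p`-th root of unity of `K̄_v` fixed by `Γ_{K_v}`), and ONE non-zero `Γ_{K_v}`-fixed `p`-torsion point of `E(K̄_v)` ⟹ SPLIT.
  Proof (Cor. V.5.4, twisted uniformisation — tree theorem `Silverman1994_thmV53_corV54_tateUniformisation_holds`): were the twist
  character non-trivial (`σ₀ t ≠ t`), a rational `P = Ψ(u)` of order `p` has `u^p = q^k`, `u·σ₀u = q^m`, so `2k = pm`, `p ∣ k`,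
  `u = ζ q^{k/p}` with `ζ ∈ μ_p`, `P = Ψ(ζ)` and `σ₀ • P = −Ψ(σ₀ζ) = −P`, whence `2P = 0 = pP`, `P = 0`; so every `σ` fixes
  `t = √γ`, `γ` is a square in `K_v`, and the first theorem applies. (More than `p` rational `p`-torsion points force splitting for
  any odd `p` — tree `hasSplitMultiplicativeReductionAt_of_odd_torsion`; ONE point suffices exactly when `μ_p ⊂ K_v`.)

HONEST FRAMING. Theorems only (no definition, no named fact, no `sorry`); general; nothing about the crux is asserted. PARTITION:
O2@3 (B10) × A1 × crux 19574 × S1 first floor (rational lifts: the `hsplit` hypothesis) — hygiene ∕ proves-glue; closes: none (T7).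

References: [cite: SilvermanATAEC1994, Ch. V Lemma 5.2 (c), Thm. 5.3 (a),(b), Cor. 5.4] [cite: SilvermanAEC2009, Prop. VII.5.1 (b)].
-/

noncomputable section

open scoped Classical

open NumberField IsDedekindDomain Field WeierstrassCurve
open Literature.NumberTheory.EllipticCurves Literature.NumberTheory.GaloisRepresentations
open Literature.NumberTheory.EllipticCurves.TateCurve Literature.NumberTheory.EllipticCurves.SteinWuthrich2013

namespace Summit.BirchSwinnertonDyer.Rank1Residual.X11b.Three.Koly.RationalLift

variable {K : Type} [Field K] [NumberField K] (W : WeierstrassCurve K) [W.IsElliptic] (v : HeightOneSpectrum (𝓞 K))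

/-- **Silverman ATAEC V.5.3 (b) (ii) ⇒ (iii) at a finite place**: multiplicative reduction at `v` and `−c₄/c₆` a square in `K_v` ⟹ SPLIT
multiplicative reduction at `v`. [cite: SilvermanATAEC1994, Ch. V Thm. 5.3 (b)] -/
theorem hasSplitMultiplicativeReductionAt_of_isSquare_gamma (hmult : W.HasMultiplicativeReductionAt v)
    (hγ : IsSquare (algebraMap K (v.adicCompletion K) (-(W.c₄ / W.c₆)))) : W.HasSplitMultiplicativeReductionAt v := by
  letI := Literature.NumberTheory.GaloisRepresentations.Ultrametric.AdicCompletion.nontriviallyNormedField K v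
  haveI := charZero_adicCompletion' K v
  haveI : (W.baseChange (v.adicCompletion K)).IsElliptic :=
    inferInstanceAs (W.map (algebraMap K (v.adicCompletion K))).IsElliptic
  have hj := one_lt_norm_j_baseChange_of_hasMultiplicativeReductionAt W v hmult
  obtain ⟨q, hq0, hq, hqj, -⟩ := isomorphic_tateCurve_of_one_lt_norm_j_holds (W.baseChange (v.adicCompletion K)) hj
  have hγ' : IsSquare (-((W.baseChange (v.adicCompletion K)).c₄ / (W.baseChange (v.adicCompletion K)).c₆)) := by
    have h : -((W.baseChange (v.adicCompletion K)).c₄ / (W.baseChange (v.adicCompletion K)).c₆) =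
        algebraMap K (v.adicCompletion K) (-(W.c₄ / W.c₆)) := by
      rw [WeierstrassCurve.baseChange, map_c₄, map_c₆, map_neg, map_div₀]
    rw [h]; exact hγ
  obtain ⟨C, hC⟩ := iso_tateCurve_of_isSquare_gamma (W.baseChange (v.adicCompletion K)) hj hq0 hq hqj hγ'
  exact hasSplitMultiplicativeReductionAt_of_iso_tateCurve K v W hq hC

/-- **ONE rational point of odd prime order `p` forces SPLIT multiplicative reduction when `μ_p ⊂ K_v`.** `E = W` elliptic over a number
field `K`, `v` a finite place of multiplicative reduction, `p` an odd prime such that every `p`-th root of unity of `K̄_v` is fixed by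
`Γ_{K_v}`, and `P ∈ E(K̄_v)` a NON-ZERO `Γ_{K_v}`-fixed point with `p • P = 0`. Then the reduction at `v` is SPLIT. (Twisted Tate
uniformisation, Silverman Cor. V.5.4: in the non-split case a rational point of order `p` would be `Ψ(ζ)`, `ζ ∈ μ_p`, on which the
twist acts by `−1`.) [cite: SilvermanATAEC1994, Ch. V Lemma 5.2 (c), Thm. 5.3, Cor. 5.4] -/
theorem hasSplitMultiplicativeReductionAt_of_fixed_torsion_point (hmult : W.HasMultiplicativeReductionAt v)
    {p : ℕ} [hp : Fact p.Prime] (hp2 : p ≠ 2)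
    (hμ : ∀ ζ : (AlgebraicClosure (v.adicCompletion K))ˣ, ζ ^ p = 1 →
      ∀ σ : absoluteGaloisGroup (v.adicCompletion K),
        Units.map (absoluteGaloisGroup.toAlgEquiv _ σ :
          AlgebraicClosure (v.adicCompletion K) →* AlgebraicClosure (v.adicCompletion K)) ζ = ζ)
    {P : localPoints W (v.adicCompletion K)} (hPp : (p : ℤ) • P = 0) (hP0 : P ≠ 0)
    (hPfix : ∀ σ : absoluteGaloisGroup (v.adicCompletion K), σ • P = P) :
    W.HasSplitMultiplicativeReductionAt v := by
  have hpp : p.Prime := hp.out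
  haveI : CharZero (v.adicCompletion K) := charZero_adicCompletion v
  set Kv := v.adicCompletion K with hKv
  obtain ⟨q, t, Ψ, hq0, hq1, -, ht2, -, hker, hΨσ, hrat⟩ :=
    Silverman1994_thmV53_corV54_tateUniformisation_holds W v hmult
  set aq : AlgebraicClosure Kv := algebraMap Kv (AlgebraicClosure Kv) q with haq
  have hq' : aq ≠ 0 := by
    rw [haq, Ne, map_eq_zero_iff _ (algebraMap Kv (AlgebraicClosure Kv)).injective]; exact hq0
  obtain ⟨u, -, huN, huP⟩ := hrat P hPfix
  -- every `σ` fixes `t = √γ`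
  have hfix_t : ∀ σ : absoluteGaloisGroup Kv, absoluteGaloisGroup.toAlgEquiv Kv σ t = t := by
    intro σ
    by_contra hσ
    obtain ⟨m, hm⟩ := huN σ hσ
    -- `u ^ p ∈ q^ℤ`
    have hup0 : Ψ (Additive.ofMul (u ^ p)) = 0 := by
      rw [ofMul_pow, map_nsmul, huP, ← natCast_zsmul, hPp]
    obtain ⟨k, hk⟩ := (hker (u ^ p)).mp hup0
    have hk' : ((u : AlgebraicClosure Kv)) ^ p = aq ^ k := by rw [← Units.val_pow_eq_pow_val]; exact hk
    -- `(σ u) ^ p = q ^ k` as well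
    have hσup : ((Units.map (absoluteGaloisGroup.toAlgEquiv Kv σ :
        AlgebraicClosure Kv →* AlgebraicClosure Kv) u : (AlgebraicClosure Kv)ˣ) : AlgebraicClosure Kv) ^ p = aq ^ k := by
      rw [Units.coe_map, MonoidHom.coe_coe, ← map_pow, hk', map_zpow₀, haq, AlgEquiv.commutes]
    -- `(u · σ u) ^ p`: `q ^ (m p) = q ^ (2 k)`
    have h1 : aq ^ (m * (p : ℤ)) = aq ^ (k + k) := by
      rw [zpow_mul, zpow_natCast, ← hm, Units.val_mul, mul_pow, hk', hσup, ← zpow_add₀ hq']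
    have h2 : aq ^ (m * (p : ℤ) - (k + k)) = 1 := by
      rw [zpow_sub₀ hq', h1, div_self (zpow_ne_zero _ hq')]
    have h3 : m * (p : ℤ) - (k + k) = 0 := WeierstrassCurve.zpow_algebraMap_eq_one_imp v hq0 hq1 h2
    -- `p ∣ 2k`, `p` odd ⟹ `p ∣ k`
    have hpk : (p : ℤ) ∣ k := by
      have hdvd : (p : ℤ) ∣ 2 * k := ⟨m, by linarith⟩
      rcases (Nat.prime_iff_prime_int.mp hpp).dvd_or_dvd hdvd with h | h
      · exfalso
        have hle : (p : ℤ) ≤ 2 := Int.le_of_dvd (by norm_num) h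
        have hge := hpp.two_le
        omega
      · exact h
    obtain ⟨k', hkk'⟩ := hpk
    -- `ζ = u · q^{-k'}` is a `p`-th root of unity with `Ψ(ζ) = P`
    set qU : (AlgebraicClosure Kv)ˣ := Units.mk0 aq hq' with hqU
    set ζ : (AlgebraicClosure Kv)ˣ := u * qU ^ (-k') with hζdef
    have hζp : ζ ^ p = 1 := by
      apply Units.ext
      rw [Units.val_pow_eq_pow_val, hζdef, Units.val_mul, mul_pow, hk', Units.val_zpow_eq_zpow_val, hqU, Units.val_mk0,
        ← zpow_natCast (aq ^ (-k')), ← zpow_mul, ← zpow_add₀ hq', Units.val_one, hkk']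
      have : (p : ℤ) * k' + -k' * (p : ℤ) = 0 := by ring
      rw [this, zpow_zero]
    have hqU0 : Ψ (Additive.ofMul qU) = 0 := (hker qU).mpr ⟨1, by rw [hqU, Units.val_mk0, zpow_one]⟩
    have hζP : Ψ (Additive.ofMul ζ) = P := by
      rw [hζdef, ofMul_mul, map_add, huP, ofMul_zpow, map_zsmul, hqU0, zsmul_zero, add_zero]
    -- the twist acts by `−1` on `P`: `σ • P = −P`
    have hσP : σ • P = -P := by
      rw [← hζP, hΨσ σ ζ, if_neg hσ, hμ ζ hζp σ, neg_one_zsmul]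
    rw [hPfix σ] at hσP
    -- `2 • P = 0` and `p • P = 0` with `p` odd force `P = 0`
    have h2P : (2 : ℕ) • P = 0 := by
      rw [two_nsmul]
      nth_rewrite 1 [hσP]
      exact neg_add_cancel P
    obtain ⟨j, hj⟩ := hpp.odd_of_ne_two hp2
    have hPnat : p • P = 0 := by rw [← natCast_zsmul]; exact hPp
    apply hP0
    have h := succ_nsmul P p
    rw [hPnat, zero_add, hj, show 2 * j + 1 + 1 = (j + 1) * 2 by ring, mul_smul, h2P, smul_zero] at h
    exact h.symm
  -- hence `t ∈ K_v` and `γ = t²` is a square in `K_v`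
  haveI : IsGalois Kv (AlgebraicClosure Kv) := IsAlgClosure.isGalois Kv (AlgebraicClosure Kv)
  obtain ⟨r, hr⟩ := (InfiniteGalois.mem_range_algebraMap_iff_fixed t).mpr fun f ↦ by
    have h := hfix_t ((absoluteGaloisGroup.toAlgEquiv Kv).symm f)
    rwa [MulEquiv.apply_symm_apply] at h
  have hγ : IsSquare (algebraMap K Kv (-(W.c₄ / W.c₆))) := by
    refine ⟨r, (algebraMap Kv (AlgebraicClosure Kv)).injective ?_⟩
    rw [map_mul, hr, ← sq, ht2]
  exact hasSplitMultiplicativeReductionAt_of_isSquare_gamma W v hmult hγ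

end Summit.BirchSwinnertonDyer.Rank1Residual.X11b.Three.Koly.RationalLift

end
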